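import Mathlib.Tactic.FieldSimp
import Literature.Probability.LatticeModels.PercolationRowEdgeOperators
import Literature.Probability.LatticeModels.PercolationRowJunctionCalculus

/-!
# Absorption of the bottom-arc class: crossing amplitudes decay geometrically at fixed width

For the stochastic row-to-row transfer matrix `T_S = PercolationRowTransfer S` of bond
percolation on `ℤ²` at `p = 1/2` (`Literature.Probability.LatticeModels.PercolationRowTransfer`):

* `RowState.Dead π` — no site of the row is joined to the bottom arc `⋆`; equivalently
  (`RowState.dead_iff_le_starSplit`) the partition refines the two-class partition `starSplit S`
  separating `⋆` from the sites; `rowReadout S π = 0` iff `π` is dead.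
* **Dead states are absorbing** (`RowState.Dead.rowStep`): a row step never joins a site to `⋆`
  except through old connections (the vertical layer only removes connections, `vertRel_le`; the
  horizontal layer joins sites to sites, `horizRel_le_starSplit`). Closing every vertical edge
  kills the row at once (`RowState.dead_rowStep_empty`), which happens with probability
  `2^{-|S|}`.
* Hence the **crossing functional contracts**: for a nonnegative distribution `μ`,
  `⟨μ T_S, β_S⟩ ≤ (1 - 2^{-|S|}) ⟨μ, β_S⟩` (`readout_transferLin_le`), and the bottom-to-top
  crossing amplitude of `m` rows over the columns `S` started from the wired row obeys
  `⟨α_S T_S^m, β_S⟩ ≤ (1 - 2^{-|S|})^m` (`readout_transferLin_iterate_rowBoundary_le`): at fixed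
  width it decays at least geometrically in the height, i.e. the stationary eigenvalue `1` of the
  stochastic matrix `T_S` is invisible from the boundary data `(α_S, β_S)` — the amplitudes
  `⟨α| T^m |β⟩` of Cardy / Bondesan–Jacobsen–Saleur live on the substochastic block of `T_S` on
  the live states (route `CriticalPhenomena/CardyPolygonWords`, items `JunctionOverlapLimit`,
  `CardyRectangle`: the "visible spectrum" lies strictly inside the unit disc).
* **The live class is irreducible and aperiodic over a gap-free column set**
  (`rowStep_univ_hEdges_of_not_dead`, `percolationRowTransfer_wired_pos`): from every live state
  the all-edges-open configuration returns to the wired state in one step, so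
  `T_S (π, wired) > 0` — the input for Perron–Frobenius on the live block (a real simple leading
  visible eigenvalue `λ₁(S)` with positive vectors).

Sources: J. Cardy, arXiv:math-ph/0103018, §7.1 (`Cardy2001`: `P = ⟨a|e^{-WH}|b⟩` decays
exponentially in the aspect ratio); Bondesan–Jacobsen–Saleur, arXiv:1207.7005, §2
(`BondesanJacobsenSaleur2012`). The finite-width statements here are elementary ([folklore]);
the sharp rate `λ₁(S)` with `|S|·(1 - λ₁) → π/3` (boundary exponent `h_{1,3} = 1/3`) is NOT
claimed.
-/

noncomputable section

open Finset Matrix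
open scoped BigOperators Classical

namespace Literature.Probability.LatticeModels

variable {S : Finset ℤ}

/-! ### The star-separating partition and dead states -/

/-- The two-class partition of the row points separating `⋆` from the sites
(`a ~ b` iff both or neither are `⋆`): the kernel of `Sum.isRight : S ⊕ Unit → Bool`.
[folklore] -/
def starSplit (S : Finset ℤ) : Setoid (RowPoint S) :=
  Setoid.ker Sum.isRight

/-- Unfolding lemma for `starSplit`. [folklore] -/
theorem starSplit_apply (a b : RowPoint S) : starSplit S a b ↔ a.isRight = b.isRight :=
  Setoid.ker_def

/-- Every horizontal-edge relation refines `starSplit` (it joins two sites). [folklore] -/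
theorem hEdgeRel_le_starSplit (x : S) : hEdgeRel x ≤ starSplit S := by
  by_cases h : (x : ℤ) + 1 ∈ S
  · rw [hEdgeRel_of_mem x h, joinTwo_le_iff]
    rfl
  · rw [hEdgeRel_of_not_mem x h]
    exact bot_le

/-- The horizontal layer keeps a partition below `starSplit`. [folklore] -/
theorem horizRel_le_starSplit (H : Finset S) {π : Setoid (RowPoint S)} (h : π ≤ starSplit S) :
    horizRel H π ≤ starSplit S :=
  sup_le h (Finset.sup_le fun x _ => hEdgeRel_le_starSplit x)

/-- With every vertical edge closed, the new row is below `starSplit` whatever the old one.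
[folklore] -/
theorem vertRel_empty_le_starSplit (π : Setoid (RowPoint S)) : vertRel ∅ π ≤ starSplit S := by
  intro a b hab
  rcases hab with rfl | ⟨ha, hb, -⟩
  · rfl
  · rcases a with x | u
    · simp [IsUp] at ha
    · rcases b with y | v
      · simp [IsUp] at hb
      · rfl

namespace RowState

/-- **A dead state**: no site of the row is joined to the bottom arc `⋆` (the crossing has already
failed below this row). [cite: Cardy2001, §7.1] -/
def Dead (π : RowState S) : Prop :=
  ∀ x : S, ¬ π.JoinedToStar x

/-- A state is dead iff its partition refines `starSplit`. [folklore] -/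
theorem dead_iff_le_starSplit (π : RowState S) : π.Dead ↔ π.rel ≤ starSplit S := by
  constructor
  · intro h a b hab
    rcases a with x | u <;> rcases b with y | v
    · rfl
    · cases v
      exact absurd hab (h x)
    · cases u
      exact absurd (π.rel.symm' hab) (h y)
    · rfl
  · intro h x hx
    exact Bool.false_ne_true (h hx)

/-- The free state is dead. [folklore] -/
theorem dead_free (S : Finset ℤ) : (free S).Dead := by
  intro x hx
  exact Sum.inl_ne_inr (hx : (Sum.inl x : RowPoint S) = RowPoint.star S)

/-- The wired state over a nonempty column set is alive. [folklore] -/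
theorem not_dead_wired (x : S) : ¬ (wired S).Dead :=
  fun h => h x trivial

/-- **Dead states are absorbing under every row step.** [cite: Cardy2001, §7.1] -/
theorem Dead.rowStep {π : RowState S} (h : π.Dead) (O H : Finset S) :
    (LatticeModels.rowStep O H π).Dead := by
  rw [dead_iff_le_starSplit] at h ⊢
  exact horizRel_le_starSplit H ((vertRel_le O π.rel).trans h)

/-- Closing every vertical edge kills the row. [folklore] -/
theorem dead_rowStep_empty (π : RowState S) (H : Finset S) :
    (LatticeModels.rowStep ∅ H π).Dead := by
  rw [dead_iff_le_starSplit]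
  exact horizRel_le_starSplit H (vertRel_empty_le_starSplit π.rel)

end RowState

/-! ### The read-out functional on dead / live states -/

/-- The read-out vanishes on dead states. [folklore] -/
theorem rowReadout_of_dead {π : RowState S} (h : π.Dead) : rowReadout S π = 0 := by
  unfold rowReadout
  rw [if_neg (not_exists.mpr h)]

/-- The read-out is `1` on live states. [folklore] -/
theorem rowReadout_of_not_dead {π : RowState S} (h : ¬ π.Dead) : rowReadout S π = 1 := by
  unfold rowReadout
  unfold RowState.Dead at h
  rw [if_pos (not_forall_not.mp h)]

/-- The read-out is `0` or `1`. [folklore] -/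
theorem rowReadout_nonneg (π : RowState S) : 0 ≤ rowReadout S π :=
  (rowReadout_mem_Icc S π).1

/-- **The read-out never increases along a row step** (dead stays dead). [cite: Cardy2001, §7.1] -/
theorem rowReadout_rowStep_le (O H : Finset S) (π : RowState S) :
    rowReadout S (rowStep O H π) ≤ rowReadout S π := by
  by_cases h : π.Dead
  · rw [rowReadout_of_dead (h.rowStep O H)]
    exact rowReadout_nonneg π
  · rw [rowReadout_of_not_dead h]
    exact (rowReadout_mem_Icc S _).2

/-- With every vertical edge closed the read-out of the new row is `0`. [folklore] -/
theorem rowReadout_rowStep_empty (H : Finset S) (π : RowState S) :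
    rowReadout S (rowStep ∅ H π) = 0 :=
  rowReadout_of_dead (RowState.dead_rowStep_empty π H)

/-! ### Contraction of the crossing functional -/

/-- Summed over all bond configurations of one row step, the read-out of the new row is at most
`(2^|S| - 1) · 2^|hEdges S|` times the read-out of the old row: the `2^|hEdges S|` configurations
with all vertical edges closed contribute nothing. [folklore] -/
theorem sum_rowReadout_rowStep_le (π : RowState S) :
    ∑ OH ∈ (univ : Finset (Finset S)) ×ˢ (hEdges S).powerset, rowReadout S (rowStep OH.1 OH.2 π) ≤
      ((2 : ℝ) ^ S.card - 1) * 2 ^ (hEdges S).card * rowReadout S π := by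
  rw [Finset.sum_product, ← Finset.add_sum_erase _ _ (mem_univ (∅ : Finset S))]
  simp only [rowReadout_rowStep_empty, Finset.sum_const_zero, zero_add]
  calc ∑ O ∈ univ.erase (∅ : Finset S), ∑ H ∈ (hEdges S).powerset, rowReadout S (rowStep O H π)
      ≤ ∑ O ∈ univ.erase (∅ : Finset S), ∑ H ∈ (hEdges S).powerset, rowReadout S π :=
        Finset.sum_le_sum fun O _ => Finset.sum_le_sum fun H _ => rowReadout_rowStep_le O H π
    _ = ((2 : ℝ) ^ S.card - 1) * 2 ^ (hEdges S).card * rowReadout S π := by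
        rw [Finset.sum_const, Finset.sum_const, card_powerset, Finset.card_erase_of_mem (mem_univ _),
          card_univ, Fintype.card_finset, Fintype.card_coe, nsmul_eq_mul, nsmul_eq_mul,
          Nat.cast_sub (Nat.one_le_two_pow), Nat.cast_pow, Nat.cast_pow]
        push_cast
        ring

/-- **Contraction of the crossing functional.** For a nonnegative distribution `μ` on row states,
one transfer step loses at least the fraction `2^{-|S|}` of the live mass:
`⟨μ T_S, β_S⟩ ≤ (1 - 2^{-|S|}) ⟨μ, β_S⟩`. [cite: Cardy2001, §7.1] -/
theorem readout_transferLin_le {μ : RowState S → ℝ} (hμ : ∀ π, 0 ≤ μ π) :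
    ∑ π', transferLin S μ π' * rowReadout S π' ≤
      (1 - ((2 : ℝ) ^ S.card)⁻¹) * ∑ π, μ π * rowReadout S π := by
  have hc : (0 : ℝ) < (2 : ℝ) ^ S.card * 2 ^ (hEdges S).card := by positivity
  rw [transferLin_eq_average]
  simp only [LinearMap.smul_apply, LinearMap.coe_sum, Finset.sum_apply, Pi.smul_apply,
    smul_eq_mul]
  calc ∑ π', ((2 : ℝ) ^ S.card * 2 ^ (hEdges S).card)⁻¹ *
          (∑ OH ∈ (univ : Finset (Finset S)) ×ˢ (hEdges S).powerset,
            statePushforward (rowStep OH.1 OH.2) μ π') * rowReadout S π'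
      = ((2 : ℝ) ^ S.card * 2 ^ (hEdges S).card)⁻¹ *
          ∑ π, μ π * ∑ OH ∈ (univ : Finset (Finset S)) ×ˢ (hEdges S).powerset,
            rowReadout S (rowStep OH.1 OH.2 π) := by
        simp_rw [mul_assoc, ← Finset.mul_sum, Finset.sum_mul]
        rw [Finset.sum_comm]
        simp_rw [sum_statePushforward_mul, Finset.mul_sum]
        rw [Finset.sum_comm]
    _ ≤ ((2 : ℝ) ^ S.card * 2 ^ (hEdges S).card)⁻¹ *
          ∑ π, μ π * (((2 : ℝ) ^ S.card - 1) * 2 ^ (hEdges S).card * rowReadout S π) := by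
        gcongr with π _
        · exact hμ π
        · exact sum_rowReadout_rowStep_le π
    _ = (1 - ((2 : ℝ) ^ S.card)⁻¹) * ∑ π, μ π * rowReadout S π := by
        rw [Finset.mul_sum, Finset.mul_sum]
        refine Finset.sum_congr rfl fun π _ => ?_
        field_simp

/-- The transfer step preserves nonnegativity of distributions. [folklore] -/
theorem transferLin_nonneg {μ : RowState S → ℝ} (hμ : ∀ π, 0 ≤ μ π) (π' : RowState S) :
    0 ≤ transferLin S μ π' := by
  simp only [transferLin, Matrix.vecMulLinear_apply, Matrix.vecMul, dotProduct]
  exact Finset.sum_nonneg fun π _ => mul_nonneg (hμ π) (percolationRowTransfer_nonneg S π π')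

/-- Iterates of the transfer step preserve nonnegativity. [folklore] -/
theorem transferLin_iterate_nonneg {μ : RowState S → ℝ} (hμ : ∀ π, 0 ≤ μ π) (m : ℕ)
    (π' : RowState S) : 0 ≤ ((transferLin S)^[m] μ) π' := by
  induction m generalizing π' with
  | zero => exact hμ π'
  | succ m ih =>
    rw [Function.iterate_succ_apply']
    exact transferLin_nonneg ih π'

/-- `α_S` is nonnegative. [folklore] -/
theorem rowBoundary_nonneg (π : RowState S) : 0 ≤ rowBoundary S π := by
  unfold rowBoundary
  split_ifs <;> norm_num

/-- **Geometric decay of the crossing amplitude at fixed width.** The bottom-to-top crossing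
amplitude of `m` rows over the columns `S`, `⟨α_S T_S^m, β_S⟩`, is at most `(1 - 2^{-|S|})^m`:
the stationary eigenvalue `1` of the stochastic matrix `T_S` is invisible from `(α_S, β_S)`.
[cite: Cardy2001, §7.1] -/
theorem readout_transferLin_iterate_rowBoundary_le (S : Finset ℤ) (m : ℕ) :
    ∑ π, ((transferLin S)^[m] (rowBoundary S)) π * rowReadout S π ≤
      (1 - ((2 : ℝ) ^ S.card)⁻¹) ^ m := by
  induction m with
  | zero =>
    simp only [Function.iterate_zero, id_eq, pow_zero]
    calc ∑ π, rowBoundary S π * rowReadout S π ≤ ∑ π, rowBoundary S π :=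
          Finset.sum_le_sum fun π _ =>
            mul_le_of_le_one_right (rowBoundary_nonneg π) (rowReadout_mem_Icc S π).2
      _ = 1 := sum_rowBoundary S
  | succ m ih =>
    have h0 : (0 : ℝ) ≤ 1 - ((2 : ℝ) ^ S.card)⁻¹ := by
      rw [sub_nonneg]
      exact inv_le_one_of_one_le₀ (one_le_pow₀ (by norm_num))
    rw [Function.iterate_succ_apply', pow_succ']
    exact (readout_transferLin_le (transferLin_iterate_nonneg rowBoundary_nonneg m)).trans
      (mul_le_mul_of_nonneg_left ih h0)

/-! ### Irreducibility of the live class over an interval of columns -/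

section Interval

/-- Over an order-connected (gap-free) set of columns, opening every horizontal edge joins any two
sites. [folklore] -/
theorem horizRel_hEdges_inl_inl (hS : (S : Set ℤ).OrdConnected) (π : Setoid (RowPoint S))
    (x y : S) : horizRel (hEdges S) π (Sum.inl x) (Sum.inl y) := by
  -- chain `x ~ x+1 ~ ⋯ ~ y` for `x ≤ y`, by induction on `y - x`
  have key : ∀ n : ℕ, ∀ x y : S, (y : ℤ) - x = n →
      horizRel (hEdges S) π (Sum.inl x) (Sum.inl y) := by
    intro n
    induction n with
    | zero =>
      intro x y hxy
      have : x = y := Subtype.ext (by omega)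
      subst this
      exact Setoid.refl' _ _
    | succ n ih =>
      intro x y hxy
      have hx1 : (x : ℤ) + 1 ∈ S :=
        Finset.mem_coe.mp (hS.out x.2 y.2 ⟨by omega, by omega⟩)
      have hstep : horizRel (hEdges S) π (Sum.inl x) (Sum.inl ⟨(x : ℤ) + 1, hx1⟩) := by
        have hle : hEdgeRel x ≤ horizRel (hEdges S) π :=
          (Finset.le_sup (f := hEdgeRel) ((mem_hEdges x).mpr hx1)).trans le_sup_right
        exact hle (hEdgeRel_rel x hx1)
      exact Setoid.trans' _ hstep (ih ⟨(x : ℤ) + 1, hx1⟩ y (by push_cast; omega))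
  rcases le_total (x : ℤ) y with h | h
  · exact key ((y : ℤ) - x).toNat x y (Int.toNat_of_nonneg (by omega)).symm
  · exact Setoid.symm' _ (key ((x : ℤ) - y).toNat y x (Int.toNat_of_nonneg (by omega)).symm)

/-- **One-step return to the wired state.** Over a gap-free column set, from every live state the
configuration with all vertical and all horizontal edges open produces the fully wired state: the
live class is a single communicating, aperiodic class of the row chain (the irreducibility input
for Perron–Frobenius on the live block). [folklore] -/
theorem rowStep_univ_hEdges_of_not_dead (hS : (S : Set ℤ).OrdConnected) {π : RowState S}
    (hπ : ¬ π.Dead) : rowStep univ (hEdges S) π = RowState.wired S := by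
  obtain ⟨x₀, hx₀⟩ := not_forall_not.mp hπ
  ext a b
  change horizRel (hEdges S) (vertRel univ π.rel) a b ↔ (⊤ : Setoid (RowPoint S)) a b
  rw [vertRel_univ]
  refine ⟨fun _ => trivial, fun _ => ?_⟩
  -- every row point is joined to `⋆` after opening all horizontal edges
  have hstar : ∀ c : RowPoint S, horizRel (hEdges S) π.rel c (RowPoint.star S) := by
    rintro (x | u)
    · exact Setoid.trans' _ (horizRel_hEdges_inl_inl hS π.rel x x₀) (le_horizRel _ _ hx₀)
    · cases u
      exact Setoid.refl' _ _
  exact Setoid.trans' _ (hstar a) (Setoid.symm' _ (hstar b))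

/-- Hence, over a gap-free column set, every live state moves to the wired state with positive
probability, `T_S (π, wired) > 0` (at least `2^{-|S|} · 2^{-|hEdges S|}`, the all-open
configuration; the bound itself is not recorded). [folklore] -/
theorem percolationRowTransfer_wired_pos (hS : (S : Set ℤ).OrdConnected) {π : RowState S}
    (hπ : ¬ π.Dead) : 0 < PercolationRowTransfer S π (RowState.wired S) := by
  unfold PercolationRowTransfer
  refine div_pos (Nat.cast_pos.mpr (Finset.card_pos.mpr ⟨(univ, hEdges S), ?_⟩)) (by positivity)
  rw [mem_filter]
  exact ⟨mem_product.mpr ⟨mem_univ _, mem_powerset.mpr subset_rfl⟩,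
    rowStep_univ_hEdges_of_not_dead hS hπ⟩

end Interval

end Literature.Probability.LatticeModels

end
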